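import Summits.CriticalPhenomena.PercolationContinuityZ3.Theorems.PercAnnulusCrossingBoxCrossingDefs2
import Summits.CriticalPhenomena.PercolationContinuityZ3.Theorems.PercAnnulusCrossingLandingStarts
import HarnessLib

/-!
# RSW3 lane: the typed successful-starts criterion — `StartsSecondMoment k → HardCrossingLowerBound k`

builds on p205010 (kernel theorem, internal audit signed; external expert review pending)

RSW3 lane (LANE 3 `prim-rsw3`), lead seat, gen 5.  Helper file (`--supports`); no definitions, no named facts, no sorries.
Bridges the typed Props of `PercAnnulusCrossingBoxCrossingDefs2` v3 (`Crossing.StartsSecondMomentAt p k K`: for every `n ≥ 1`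
the successful starts `M` of the block `{0..(k-1)n}×{0..n}²` glued through `[(k-1)n+1, kn]×[0,n]²` have `E[M] > 0` and
`E[M²] ≤ K·E[M]²`; `StartsSecondMoment k := ∃ K > 0, StartsSecondMomentAt p_c k K`) to the kernel criterion
`Crossing.hardCrossingLowerBound_of_starts_secondMoment` of `PercAnnulusCrossingLandingStarts` (Cauchy–Schwarz on
`{M ≥ 1} ⊆ {union crossed}` with the disjoint-edge product formulas), so that LADDER W15 reads as one implication between named
nodes: `StartsSecondMoment k → HardCrossingLowerBound k` (constant `1/K`).  Both hypotheses are OPEN at `p_c(ℤ³)`; census Q22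
(PREREG §L-add-12) prices `K` numerically.
[cite: LyonsPeres2016, §5.3 Prop. 5.11] [cite: Kesten1982, §3.3 (3.32)]
-/

noncomputable section

namespace Summit.CriticalPhenomena.PercolationContinuityZ3.Theorems.Crossing

open MeasureTheory Literature.Probability.LatticeModels Literature.Probability.Percolation SimpleGraph
open Summit.CriticalPhenomena.PercolationContinuityZ3.Theorems.SurfaceTension

/-- **`StartsSecondMomentAt p_c k K → HardCrossingLowerBound k`** (`K > 0`): a scale-uniform second-moment bound for the
successful starts of the blocks `{0..(k-1)n}×{0..n}²` glued through `[(k-1)n+1, kn]` gives hard-direction RSW at aspect `k`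
with constant `1/K` (repackaging of `hardCrossingLowerBound_of_starts_secondMoment`). [cite: LyonsPeres2016, §5.3 Prop. 5.11] -/
theorem hardCrossingLowerBound_of_startsSecondMomentAt {k : ℕ} {K : ℝ} (hK : 0 < K)
    (h : StartsSecondMomentAt (criticalProbI 3) k K) : HardCrossingLowerBound k :=
  hardCrossingLowerBound_of_starts_secondMoment hK h

/-- **`StartsSecondMoment k → HardCrossingLowerBound k`** — LADDER W15 as one implication between typed nodes.
[cite: LyonsPeres2016, §5.3 Prop. 5.11] [cite: Kesten1982, §3.3 (3.32)] -/
theorem hardCrossingLowerBound_of_startsSecondMoment {k : ℕ} (h : StartsSecondMoment k) : HardCrossingLowerBound k := by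
  obtain ⟨K, hK, hKk⟩ := h
  exact hardCrossingLowerBound_of_startsSecondMomentAt hK hKk

end Summit.CriticalPhenomena.PercolationContinuityZ3.Theorems.Crossing

end
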